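/-
Copyright (c) 2026 the pub-hodgecm-mathlib formalisation cell (harness21).  Prover seat hodgecm-mathlib-K2E5-p16 (g2), Track B «K2-LIT» ∕ h413 = `stmt-HodgeConjecture-24833`,
engine E5 «TamagawaUnitary», unit G «ZETA»: organ (Z1) «COMPARISON TEST FUNCTIONS» of cert §6 (K2E5-plan (g2) SWEEP #17 (a); K2E5-p03 (g2)'s (32) lead, Euler datum ‹ZE›
clauses [SB] + [POISSON]).  2026-09-04.
-/
import Summits.HodgeConjecture.HodgeConjecture.Theorems.K2E5QuatAdelicCoordinates   -- ★ (p855359, this lineage): `quatCoordInv`, `quatCoordInv_quatCoord` (+ ★ #3g `quatSchwartzBruhat`, `quatBasis`, `quatCoord`)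
import Literature.NumberTheory.Automorphic.AdelicPiSchwartzBruhatDensity             -- ★ `bump_mul_indicator_mem_piSchwartzBruhatReal`, `isCompact_piAdeleBox` (+ ★ `piArch`, `piFinite`, `piAdeleSplit`, `piSchwartzBruhat`)
import Literature.NumberTheory.Automorphic.FiniteAdeleFactorizable                    -- ★ `piLevelIdeal`, `localCosetBox`, `cosetFamily`, `piProd_cosetFamily` (coset indicators are pure tensors)
import Literature.NumberTheory.Automorphic.SchwartzBruhatCosetIndicator               -- ★ `isCompact_piLevelIdeal`
import Literature.NumberTheory.Automorphic.AdelicSecondCountable                      -- ★ `secondCountableTopology_adeleRing`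
import HarnessLib

/-!
# K2 ∕ E5 «TamagawaUnitary», unit G «ZETA» — organ (Z1) `K2E5QuatComparisonTestFunction`: the test functions of the zeta-ratio comparison

Cell `hodgecm-mathlib` (Track B «K2-LIT»), item h413 = `stmt-HodgeConjecture-24833`; dealt BY NAME by K2E5-plan (g2), SWEEP #17 (a) (2026-09-04T01:06Z), to K2E5-p16 (g2),
under K2E5-p03 (g2)'s cert §6 lead ((32); Euler datum ‹ZE› `K2/K2E5-p03/g2/sock_ZE.txt`, clauses [SB] `Φᵢ ∈ quatSchwartzBruhat L (quatBasis hᵢ)` and [POISSON]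
`∫ Φ₁ ∘ quatCoord₁ dν⁴ = ∫ Φ₂ ∘ quatCoord₂ dν⁴ ≠ 0`).  DEFINITION lane (3 small `def`s + theorems; no instance, no notation, no named fact, no `sorry`;
`--supports stmt-HodgeConjecture-24833 --as helper`).

THE CONSTRUCTION (SPEC `Lines/K2_E5_TamagawaUnitary_Zeta_ED3_SPEC.md` §1 STEP 2).  Everything happens on the coordinate space `𝔸_K^ι` (`K = L⁺`, `ι = Fin 4`) and is then
carried to `D_{h,𝔸} ⊂ M₂(𝔸_L)` by the inverse coordinates ★ `quatCoordInv` of the basis ★ `quatBasis h`: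
* §1 `cosetTestFun K ι Ψ∞ 𝔫 c := Ψ∞ ⊗ 1_{c + (𝔫𝒪̂_K)^ι}` — an archimedean Schwartz function `Ψ∞` on `(K ⊗ ℝ)^ι` (a PARAMETER) tensor the indicator of the coset of the
  LEVEL BOX ★ `piLevelIdeal K ι 𝔫 = (𝔫𝒪̂_K)^ι` (`𝔫 = ∏_{v∈S} v^{k_v}` encodes the bad set `S` and the saturation depth) centred at `c ∈ (𝔸_{K,f})^ι`.  Its finite part is the
  ★ PURE TENSOR `∏_v 1_{localCosetBox K ι 𝔫 c v}` (`cosetTestFun_eq_mul_piProd`, ★ `piProd_cosetFamily`) with local box `= 𝒪_v^ι` for `v ∤ 𝔫`, `c` `v`-integral (★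
  `localCosetBox_eq_integralBox`) — the shape the Euler factorisation [EULER]∕(E1) (K2E5-p04 (g2)) reads its local factors from.  It is a Schwartz–Bruhat function
  (`cosetTestFun_mem_piSchwartzBruhat`), a TRANSLATE of the centred one (`cosetTestFun_eq_centred_sub`), hence **its integral against any left-invariant measure does not
  depend on the centre `c`** (`integral_cosetTestFun_eq_centred`) — this is why the Poisson numerator of G3 is the SAME number for two planes `h₁, h₂`.
* §2 `archBump K ι` — a fixed smooth bump (`ContDiffBump 0`, radii `1 < 2`) on `(K ⊗ ℝ)^ι` as a complex Schwartz function: the DEFAULT `Ψ∞`, for which the centred test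
  function has POSITIVE integral against every additive Haar measure (`integral_cosetTestFun_archBump_pos`, `…_ne_zero`): non-negative, continuous, compactly supported
  (★ `isCompact_piAdeleBox`), `= 1` at `0`, Mathlib `Continuous.integral_pos_of_hasCompactSupport_nonneg_nonzero`.
* §3 `quatCompTestFun L hHa hdet Ψ := Ψ ∘ quatCoordInv` on `M₂(𝔸_L)`: `quatCompTestFun Ψ ∘ quatCoord = Ψ` (★ `quatCoordInv_quatCoord`), so [SB] is `Ψ ∈ piSchwartzBruhat`
  (★ #3g `mem_quatSchwartzBruhat_iff` is definitional) and the Poisson integrand IS `Ψ` (`integral_quatCompTestFun_quatCoord`).  The comparison test functions of record are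
  `Φᵢ := quatCompTestFun L hHaᵢ hdetᵢ (cosetTestFun L⁺ (Fin 4) Ψ∞ 𝔫 cᵢ)` with centre `cᵢ := quatCompCentre L hHaᵢ hdetᵢ = piFinite (quatCoordInv_{hᵢ} 1)` (the finite
  coordinates of `1 ∈ D_{hᵢ}`; so the local box at `v ∈ S` is `1 + 𝔫_v M_v(hᵢ)` in `D_v`, and `M_v(hᵢ) = coord(𝒪_v⁴)` off `S`); **`comparisonTestFun_spec`** = the clauses
  [SB] + [POISSON]-equality of ‹ZE› for two planes, token for token, and `comparisonTestFun_integral_ne_zero` = [POISSON]-`≠ 0` for `Ψ∞ = archBump`.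

Sources: [WeilBNT1967] A. Weil, *Basic Number Theory* (1967), Ch. VII §2 (standard functions on `𝔸^n`), §6; [CasselsFrohlichANT1967] Ch. XV (J. Tate) §3.2–§3.3, §4.2 (Lemma
4.2.4), Thm. 4.4.1; [VignerasLNM800] M.-F. Vignéras, LNM 800 (1980), Ch. II §4, Ch. III §1 (`X_A ≅ K_A⁴` on a basis), §2 Thm. 2.2–2.3; [Weil1982] Ch. III §3.1; [GetzHahn2024] §9.2.
HONEST LABEL: HC_CM is proved only modulo the 7 printed citations (2 remaining named inputs: hLiu418 = stmt-HodgeConjecture-24832, h413 = stmt-HodgeConjecture-24833) until rung 0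
closes; count-neutral helper.
-/

set_option autoImplicit false
set_option linter.dupNamespace false

noncomputable section

open MeasureTheory MeasureTheory.Measure Filter Topology NumberField NumberField.mixedEmbedding IsDedekindDomain Set Metric
open Literature.NumberTheory.Automorphic
open Summit.HodgeConjecture.HodgeConjecture.Cruxes.H413.K2E5QuatAdelicMatrixModel
open Summit.HodgeConjecture.HodgeConjecture.Cruxes.H413.K2E5QuatZeta
open Summit.HodgeConjecture.HodgeConjecture.Cruxes.H413.K2E5QuatAdelicCoordinates
open scoped SchwartzMap Classical

namespace Summit.HodgeConjecture.HodgeConjecture.Cruxes.H413.K2E5QuatComparisonTestFunction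

/-! ## §1 Coset test functions `Ψ∞ ⊗ 1_{c + (𝔫𝒪̂)^ι}` on `𝔸_K^ι` -/

section Coset

variable (K : Type) [Field K] [NumberField K] (ι : Type) [Fintype ι]

/-- **The coset test function `Ψ∞ ⊗ 1_{c + (𝔫𝒪̂_K)^ι}` on `𝔸_K^ι`**: `a ↦ Ψ∞(a_∞) · 1_{(𝔫𝒪̂_K)^ι}(a_f − c)` — an archimedean Schwartz function times the indicator of the coset
`c + (𝔫𝒪̂_K)^ι` of the level box ★ `piLevelIdeal K ι 𝔫`. [cite: WeilBNT1967, Ch. VII §2] [cite: CasselsFrohlichANT1967, Ch. XV (Tate) §4.2] -/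
def cosetTestFun (Ψinf : 𝓢((ι → mixedSpace K), ℂ)) (𝔫 : Ideal (𝓞 K)) (c : ι → FiniteAdeleRing (𝓞 K) K) :
    (ι → AdeleRing (𝓞 K) K) → ℂ :=
  fun a => Ψinf (piArch K ι a) *
    (piLevelIdeal K ι 𝔫 : Set (ι → FiniteAdeleRing (𝓞 K) K)).indicator (fun _ => (1 : ℂ)) (piFinite K ι a - c)

variable {K ι}

/-- Unfolding of `cosetTestFun`. [folklore] -/
theorem cosetTestFun_apply (Ψinf : 𝓢((ι → mixedSpace K), ℂ)) (𝔫 : Ideal (𝓞 K)) (c : ι → FiniteAdeleRing (𝓞 K) K) (a : ι → AdeleRing (𝓞 K) K) :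
    cosetTestFun K ι Ψinf 𝔫 c a =
      Ψinf (piArch K ι a) * (piLevelIdeal K ι 𝔫 : Set (ι → FiniteAdeleRing (𝓞 K) K)).indicator (fun _ => (1 : ℂ)) (piFinite K ι a - c) :=
  rfl

/-- On the coset (`a_f − c ∈ (𝔫𝒪̂)^ι`) the test function is `Ψ∞(a_∞)`. [folklore] -/
theorem cosetTestFun_apply_of_mem (Ψinf : 𝓢((ι → mixedSpace K), ℂ)) (𝔫 : Ideal (𝓞 K)) (c : ι → FiniteAdeleRing (𝓞 K) K) {a : ι → AdeleRing (𝓞 K) K}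
    (ha : piFinite K ι a - c ∈ piLevelIdeal K ι 𝔫) : cosetTestFun K ι Ψinf 𝔫 c a = Ψinf (piArch K ι a) := by
  rw [cosetTestFun_apply, Set.indicator_of_mem (show piFinite K ι a - c ∈ (piLevelIdeal K ι 𝔫 : Set _) from ha), mul_one]

/-- Off the coset the test function vanishes. [folklore] -/
theorem cosetTestFun_apply_of_not_mem (Ψinf : 𝓢((ι → mixedSpace K), ℂ)) (𝔫 : Ideal (𝓞 K)) (c : ι → FiniteAdeleRing (𝓞 K) K) {a : ι → AdeleRing (𝓞 K) K}
    (ha : piFinite K ι a - c ∉ piLevelIdeal K ι 𝔫) : cosetTestFun K ι Ψinf 𝔫 c a = 0 := by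
  rw [cosetTestFun_apply, Set.indicator_of_notMem (show piFinite K ι a - c ∉ (piLevelIdeal K ι 𝔫 : Set _) from ha), mul_zero]

/-- **The finite part is a pure tensor**: `cosetTestFun Ψ∞ 𝔫 c a = Ψ∞(a_∞) · (∏_v 1_{localCosetBox K ι 𝔫 c v})(a_f)` (★ `piProd_cosetFamily`: the coset indicator IS the
restricted product of the local coset-box indicators; `localCosetBox = 𝒪_v^ι` for `v ∤ 𝔫` with `c` `v`-integral, ★ `localCosetBox_eq_integralBox`) — the letter the Euler
factorisation of socket G10 reads. [cite: CasselsFrohlichANT1967, Ch. XV (Tate) §3.3, Thm. 4.4.1] [cite: WeilBNT1967, Ch. VII §2] -/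
theorem cosetTestFun_eq_mul_piProd (Ψinf : 𝓢((ι → mixedSpace K), ℂ)) {𝔫 : Ideal (𝓞 K)} (h𝔫 : 𝔫 ≠ 0) (c : ι → FiniteAdeleRing (𝓞 K) K) (a : ι → AdeleRing (𝓞 K) K) :
    cosetTestFun K ι Ψinf 𝔫 c a = Ψinf (piArch K ι a) * piProd K ι (cosetFamily K ι h𝔫 c) (piFinite K ι a) := by
  rw [cosetTestFun_apply, piProd_cosetFamily K ι h𝔫 c]
  rfl

omit [Fintype ι] in
/-- **Local reading of the coset condition**: `a_f − c ∈ (𝔫𝒪̂)^ι` iff every local tuple `(a_{f,i,v})_i` lies in `localCosetBox K ι 𝔫 c v` (★ `sub_mem_piLevelIdeal_iff`).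
[cite: CasselsFrohlichANT1967, Ch. XV (Tate) §3.3] -/
theorem cosetTestFun_support_iff (𝔫 : Ideal (𝓞 K)) (c : ι → FiniteAdeleRing (𝓞 K) K) (a : ι → AdeleRing (𝓞 K) K) :
    piFinite K ι a - c ∈ piLevelIdeal K ι 𝔫 ↔ ∀ v : HeightOneSpectrum (𝓞 K), (fun i => piFinite K ι a i v) ∈ localCosetBox K ι 𝔫 c v :=
  sub_mem_piLevelIdeal_iff K ι

/-- The translate of the level box by `c` is compact and open-closed in `(𝔸_{K,f})^ι`. [cite: WeilBNT1967, Ch. VII §2] -/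
theorem isClopen_isCompact_coset (𝔫 : Ideal (𝓞 K)) (c : ι → FiniteAdeleRing (𝓞 K) K) :
    IsClopen ((fun x : ι → FiniteAdeleRing (𝓞 K) K => x - c) ⁻¹' (piLevelIdeal K ι 𝔫 : Set (ι → FiniteAdeleRing (𝓞 K) K))) ∧
      IsCompact ((fun x : ι → FiniteAdeleRing (𝓞 K) K => x - c) ⁻¹' (piLevelIdeal K ι 𝔫 : Set (ι → FiniteAdeleRing (𝓞 K) K))) := by
  have hopen : IsOpen (piLevelIdeal K ι 𝔫 : Set (ι → FiniteAdeleRing (𝓞 K) K)) := isOpen_piLevelIdeal K 𝔫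
  have hclosed : IsClosed (piLevelIdeal K ι 𝔫 : Set (ι → FiniteAdeleRing (𝓞 K) K)) := (piLevelIdeal K ι 𝔫).isClosed_of_isOpen hopen
  have hc : Continuous fun x : ι → FiniteAdeleRing (𝓞 K) K => x - c := continuous_id.sub continuous_const
  refine ⟨⟨hclosed.preimage hc, hopen.preimage hc⟩, ?_⟩
  have heq : ((fun x : ι → FiniteAdeleRing (𝓞 K) K => x - c) ⁻¹' (piLevelIdeal K ι 𝔫 : Set (ι → FiniteAdeleRing (𝓞 K) K))) =
      (fun x : ι → FiniteAdeleRing (𝓞 K) K => x + c) '' (piLevelIdeal K ι 𝔫 : Set (ι → FiniteAdeleRing (𝓞 K) K)) := by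
    ext x
    constructor
    · intro hx
      exact ⟨x - c, hx, sub_add_cancel x c⟩
    · rintro ⟨y, hy, rfl⟩
      show y + c - c ∈ (piLevelIdeal K ι 𝔫 : Set _)
      rwa [add_sub_cancel_right]
  rw [heq]
  exact (isCompact_piLevelIdeal K ι 𝔫).image (continuous_id.add continuous_const)

/-- **Coset test functions are Schwartz–Bruhat** (a pure tensor `Ψ∞ ⊗ 1_{c + (𝔫𝒪̂)^ι}`; the finite factor is the indicator of a compact open-closed set, ★
`indicator_one_mem_schwartzBruhat`, ★ `tensor_mem_piSchwartzBruhat`). [cite: WeilBNT1967, Ch. VII §2] [cite: CasselsFrohlichANT1967, Ch. XV (Tate) §3.2, §4.2] -/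
theorem cosetTestFun_mem_piSchwartzBruhat (Ψinf : 𝓢((ι → mixedSpace K), ℂ)) (𝔫 : Ideal (𝓞 K)) (c : ι → FiniteAdeleRing (𝓞 K) K) :
    cosetTestFun K ι Ψinf 𝔫 c ∈ piSchwartzBruhat K ι := by
  obtain ⟨hclopen, hcompact⟩ := isClopen_isCompact_coset (K := K) (ι := ι) 𝔫 c
  have hfin := indicator_one_mem_schwartzBruhat hclopen hcompact
  have heq : cosetTestFun K ι Ψinf 𝔫 c = fun a => Ψinf (piArch K ι a) *
      ((fun x : ι → FiniteAdeleRing (𝓞 K) K => x - c) ⁻¹' (piLevelIdeal K ι 𝔫 : Set (ι → FiniteAdeleRing (𝓞 K) K))).indicator (fun _ => (1 : ℂ)) (piFinite K ι a) := by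
    funext a
    rfl
  rw [heq]
  exact tensor_mem_piSchwartzBruhat Ψinf hfin

omit [Fintype ι] in
/-- **The adelic translation vector of a finite centre**: `t(c) := split(0, c) ∈ 𝔸_K^ι` has archimedean part `0` and finite part `c`. [folklore] -/
theorem piArch_piAdeleSplit_zero (c : ι → FiniteAdeleRing (𝓞 K) K) : piArch K ι (piAdeleSplit K ι (0, c)) = 0 :=
  piArch_piAdeleSplit (0, c)

omit [Fintype ι] in
/-- Finite part of the translation vector. [folklore] -/
theorem piFinite_piAdeleSplit_zero (c : ι → FiniteAdeleRing (𝓞 K) K) : piFinite K ι (piAdeleSplit K ι (0, c)) = c :=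
  piFinite_piAdeleSplit (0, c)

omit [Fintype ι] in
/-- `piArch` is compatible with subtraction. [folklore] -/
theorem piArch_sub (a b : ι → AdeleRing (𝓞 K) K) : piArch K ι (a - b) = piArch K ι a - piArch K ι b := by
  have h := map_sub (piAdeleSplit K ι).symm a b
  rw [piAdeleSplit_symm_apply, piAdeleSplit_symm_apply, piAdeleSplit_symm_apply] at h
  exact congrArg Prod.fst h

omit [Fintype ι] in
/-- `piFinite` is compatible with subtraction. [folklore] -/
theorem piFinite_sub (a b : ι → AdeleRing (𝓞 K) K) : piFinite K ι (a - b) = piFinite K ι a - piFinite K ι b := rfl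

/-- **A coset test function is a TRANSLATE of the centred one**: `cosetTestFun Ψ∞ 𝔫 c a = cosetTestFun Ψ∞ 𝔫 0 (a − t(c))`, `t(c) = split(0, c)`.
[cite: WeilBNT1967, Ch. VII §2] -/
theorem cosetTestFun_eq_centred_sub (Ψinf : 𝓢((ι → mixedSpace K), ℂ)) (𝔫 : Ideal (𝓞 K)) (c : ι → FiniteAdeleRing (𝓞 K) K) (a : ι → AdeleRing (𝓞 K) K) :
    cosetTestFun K ι Ψinf 𝔫 c a = cosetTestFun K ι Ψinf 𝔫 0 (a - piAdeleSplit K ι (0, c)) := by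
  rw [cosetTestFun_apply, cosetTestFun_apply, piArch_sub, piArch_piAdeleSplit_zero, sub_zero, piFinite_sub, piFinite_piAdeleSplit_zero, sub_zero]

/-- **THE POISSON NUMERATOR IS CENTRE-FREE**: for every left-invariant measure `μ` on `𝔸_K^ι` (e.g. G3's `Measure.pi fun _ => ν`),
`∫ cosetTestFun Ψ∞ 𝔫 c ∂μ = ∫ cosetTestFun Ψ∞ 𝔫 0 ∂μ` (Mathlib `integral_add_left_eq_self`).  With `c = cᵢ` the centre of the plane `hᵢ` this is the equality
`∫ Ψ^{(h₁)} dν⁴ = ∫ Ψ^{(h₂)} dν⁴` of SPEC §1 STEP 2. [cite: WeilBNT1967, Ch. VII §2, §6] [cite: CasselsFrohlichANT1967, Ch. XV (Tate) Lemma 4.2.4] -/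
theorem integral_cosetTestFun_eq_centred [MeasurableSpace (AdeleRing (𝓞 K) K)] [BorelSpace (AdeleRing (𝓞 K) K)] (μ : Measure (ι → AdeleRing (𝓞 K) K))
    [μ.IsAddLeftInvariant] (Ψinf : 𝓢((ι → mixedSpace K), ℂ)) (𝔫 : Ideal (𝓞 K)) (c : ι → FiniteAdeleRing (𝓞 K) K) :
    ∫ a, cosetTestFun K ι Ψinf 𝔫 c a ∂μ = ∫ a, cosetTestFun K ι Ψinf 𝔫 0 a ∂μ := by
  haveI := secondCountableTopology_adeleRing K
  have h : (fun a => cosetTestFun K ι Ψinf 𝔫 c a) = fun a => cosetTestFun K ι Ψinf 𝔫 0 (-(piAdeleSplit K ι (0, c)) + a) := by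
    funext a
    rw [cosetTestFun_eq_centred_sub, neg_add_eq_sub]
  rw [h, integral_add_left_eq_self]

/-- Two centres, one integral: `∫ cosetTestFun Ψ∞ 𝔫 c₁ ∂μ = ∫ cosetTestFun Ψ∞ 𝔫 c₂ ∂μ`. [cite: WeilBNT1967, Ch. VII §2] -/
theorem integral_cosetTestFun_eq_integral_cosetTestFun [MeasurableSpace (AdeleRing (𝓞 K) K)] [BorelSpace (AdeleRing (𝓞 K) K)]
    (μ : Measure (ι → AdeleRing (𝓞 K) K)) [μ.IsAddLeftInvariant]
    (Ψinf : 𝓢((ι → mixedSpace K), ℂ)) (𝔫 : Ideal (𝓞 K)) (c₁ c₂ : ι → FiniteAdeleRing (𝓞 K) K) :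
    ∫ a, cosetTestFun K ι Ψinf 𝔫 c₁ a ∂μ = ∫ a, cosetTestFun K ι Ψinf 𝔫 c₂ a ∂μ := by
  rw [integral_cosetTestFun_eq_centred μ Ψinf 𝔫 c₁, integral_cosetTestFun_eq_centred μ Ψinf 𝔫 c₂]

end Coset

/-! ## §2 The default archimedean factor: a smooth bump, and positivity of the integral -/

section Bump

variable (K : Type) [Field K] [NumberField K] (ι : Type) [Fintype ι]

/-- The bump DATA: radii `1 < 2` around `0 ∈ (K ⊗ ℝ)^ι` (Mathlib `ContDiffBump`). [folklore] -/
def archBumpData : ContDiffBump (0 : ι → mixedSpace K) := ⟨1, 2, one_pos, one_lt_two⟩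

/-- **The default archimedean test function `archBump`**: the smooth bump of `archBumpData` (`= 1` on the closed unit ball, supported in the ball of radius `2`, values in `[0,1]`)
as a complex-valued Schwartz function on `(K ⊗ ℝ)^ι` (Mathlib `HasCompactSupport.toSchwartzMap`). [cite: WeilBNT1967, Ch. VII §2] -/
def archBump : 𝓢((ι → mixedSpace K), ℂ) :=
  ((archBumpData K ι).hasCompactSupport.comp_left Complex.ofReal_zero).toSchwartzMap
    (Complex.ofRealCLM.contDiff.comp (archBumpData K ι).contDiff)

variable {K ι}

/-- Values of `archBump`: the real bump, cast to `ℂ`. [folklore] -/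
theorem archBump_apply (x : ι → mixedSpace K) : archBump K ι x = ((archBumpData K ι x : ℝ) : ℂ) := rfl

/-- `archBump 0 = 1`. [folklore] -/
theorem archBump_zero : archBump K ι 0 = 1 := by
  rw [archBump_apply, (archBumpData K ι).one_of_mem_closedBall (Metric.mem_closedBall_self (archBumpData K ι).rIn_pos.le), Complex.ofReal_one]

/-- **The centred bump test function is the complexification of a non-negative real tensor bump** `a ↦ b(a_∞) · 1_{(𝔫𝒪̂)^ι}(a_f)`. [cite: WeilBNT1967, Ch. VII §2] -/
theorem cosetTestFun_archBump_zero_apply (𝔫 : Ideal (𝓞 K)) (a : ι → AdeleRing (𝓞 K) K) :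
    cosetTestFun K ι (archBump K ι) 𝔫 0 a =
      (((archBumpData K ι (piArch K ι a)) * (piLevelIdeal K ι 𝔫 : Set (ι → FiniteAdeleRing (𝓞 K) K)).indicator 1 (piFinite K ι a) : ℝ) : ℂ) := by
  rw [cosetTestFun_apply, archBump_apply, sub_zero, Complex.ofReal_mul]
  congr 1
  by_cases h : piFinite K ι a ∈ (piLevelIdeal K ι 𝔫 : Set (ι → FiniteAdeleRing (𝓞 K) K))
  · rw [Set.indicator_of_mem h, Set.indicator_of_mem h, Pi.one_apply, Complex.ofReal_one]
  · rw [Set.indicator_of_notMem h, Set.indicator_of_notMem h, Complex.ofReal_zero]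

/-- The real tensor bump is a real Schwartz–Bruhat function (★ `bump_mul_indicator_mem_piSchwartzBruhatReal` with the compact open level box). [cite: WeilBNT1967, Ch. VII §2] -/
theorem archBumpTensor_mem_piSchwartzBruhatReal (𝔫 : Ideal (𝓞 K)) :
    (fun a : ι → AdeleRing (𝓞 K) K => (archBumpData K ι (piArch K ι a)) * (piLevelIdeal K ι 𝔫 : Set (ι → FiniteAdeleRing (𝓞 K) K)).indicator 1 (piFinite K ι a)) ∈
      piSchwartzBruhatReal K ι :=
  bump_mul_indicator_mem_piSchwartzBruhatReal (archBumpData K ι) (isCompact_piLevelIdeal K ι 𝔫) (isOpen_piLevelIdeal K 𝔫)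

/-- **POSITIVITY**: for every additive Haar measure `μ` on `𝔸_K^ι` and every level `𝔫`, `0 < ∫ b(a_∞) 1_{(𝔫𝒪̂)^ι}(a_f) dμ(a)` — the integrand is continuous, non-negative,
compactly supported (★ `isCompact_piAdeleBox`) and equals `1` at `a = 0`; Haar measures charge open sets. [cite: WeilBNT1967, Ch. VII §2] [cite: CasselsFrohlichANT1967, Ch. XV (Tate) §3.3] -/
theorem integral_archBumpTensor_pos [MeasurableSpace (AdeleRing (𝓞 K) K)] [BorelSpace (AdeleRing (𝓞 K) K)] (μ : Measure (ι → AdeleRing (𝓞 K) K)) [μ.IsAddHaarMeasure]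
    (𝔫 : Ideal (𝓞 K)) :
    0 < ∫ a, (archBumpData K ι (piArch K ι a)) * (piLevelIdeal K ι 𝔫 : Set (ι → FiniteAdeleRing (𝓞 K) K)).indicator 1 (piFinite K ι a) ∂μ := by
  haveI := secondCountableTopology_adeleRing K
  set g : (ι → AdeleRing (𝓞 K) K) → ℝ := fun a =>
    (archBumpData K ι (piArch K ι a)) * (piLevelIdeal K ι 𝔫 : Set (ι → FiniteAdeleRing (𝓞 K) K)).indicator 1 (piFinite K ι a) with hg
  have hcont : Continuous g := continuous_of_mem_piSchwartzBruhatReal (archBumpTensor_mem_piSchwartzBruhatReal (K := K) (ι := ι) 𝔫)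
  have hnonneg : 0 ≤ g := fun a =>
    mul_nonneg (archBumpData K ι).nonneg (Set.indicator_nonneg (fun _ _ => zero_le_one) _)
  have hsupp : HasCompactSupport g := by
    refine HasCompactSupport.of_support_subset_isCompact
      (isCompact_piAdeleBox (0 : ι → mixedSpace K) (archBumpData K ι).rOut (isCompact_piLevelIdeal K ι 𝔫)) fun a ha => ?_
    simp only [Function.mem_support, hg] at ha
    refine ⟨?_, ?_⟩
    · have h1 : archBumpData K ι (piArch K ι a) ≠ 0 := fun h0 => ha (by rw [h0, zero_mul])
      have h2 : piArch K ι a ∈ Function.support (archBumpData K ι : (ι → mixedSpace K) → ℝ) := h1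
      rw [(archBumpData K ι).support_eq] at h2
      exact Metric.ball_subset_closedBall h2
    · by_contra hnot
      exact ha (by rw [Set.indicator_of_notMem (show piFinite K ι a ∉ (piLevelIdeal K ι 𝔫 : Set _) from hnot), mul_zero])
  have h0 : g 0 ≠ 0 := by
    have ha : piArch K ι (0 : ι → AdeleRing (𝓞 K) K) = 0 := by
      have := piArch_sub (K := K) (ι := ι) (0 : ι → AdeleRing (𝓞 K) K) 0
      rwa [sub_self, sub_self] at this
    have hf : piFinite K ι (0 : ι → AdeleRing (𝓞 K) K) = 0 := rfl
    rw [hg]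
    dsimp only
    rw [ha, hf, (archBumpData K ι).one_of_mem_closedBall (Metric.mem_closedBall_self (archBumpData K ι).rIn_pos.le),
      Set.indicator_of_mem (show (0 : ι → FiniteAdeleRing (𝓞 K) K) ∈ (piLevelIdeal K ι 𝔫 : Set _) from (piLevelIdeal K ι 𝔫).zero_mem),
      Pi.one_apply, mul_one]
    exact one_ne_zero
  exact hcont.integral_pos_of_hasCompactSupport_nonneg_nonzero hsupp hnonneg h0

/-- **The centred bump test function has NON-ZERO (indeed positive real) integral** against every additive Haar measure on `𝔸_K^ι`.
[cite: WeilBNT1967, Ch. VII §2] [cite: CasselsFrohlichANT1967, Ch. XV (Tate) Lemma 4.2.4] -/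
theorem integral_cosetTestFun_archBump_ne_zero [MeasurableSpace (AdeleRing (𝓞 K) K)] [BorelSpace (AdeleRing (𝓞 K) K)] (μ : Measure (ι → AdeleRing (𝓞 K) K))
    [μ.IsAddHaarMeasure] (𝔫 : Ideal (𝓞 K)) (c : ι → FiniteAdeleRing (𝓞 K) K) :
    ∫ a, cosetTestFun K ι (archBump K ι) 𝔫 c a ∂μ ≠ 0 := by
  rw [integral_cosetTestFun_eq_centred μ (archBump K ι) 𝔫 c]
  have h : (fun a => cosetTestFun K ι (archBump K ι) 𝔫 0 a) = fun a =>
      (((archBumpData K ι (piArch K ι a)) * (piLevelIdeal K ι 𝔫 : Set (ι → FiniteAdeleRing (𝓞 K) K)).indicator 1 (piFinite K ι a) : ℝ) : ℂ) :=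
    funext fun a => cosetTestFun_archBump_zero_apply 𝔫 a
  rw [h, integral_complex_ofReal, Complex.ofReal_ne_zero]
  exact (integral_archBumpTensor_pos μ 𝔫).ne'

end Bump

/-! ## §3 On `D_{h,𝔸}`: composition with the inverse coordinates, and the ‹ZE› clauses [SB] + [POISSON] -/

section Quat

variable (L : Type) [Field L] [NumberField L] [IsCMField L] {Ha : Matrix (Fin 2) (Fin 2) L}

/-- **`quatCompTestFun Ψ := Ψ ∘ quatCoordInv`**: a function on the coordinate space `(𝔸⁺)⁴` carried to the ambient `M₂(𝔸_L)` of `D_{h,𝔸}` through the inverse coordinates of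
the basis ★ `quatBasis h` (★ `quatCoordInv`). [cite: VignerasLNM800, Ch. III §1] -/
def quatCompTestFun (hHa : (Ha.map (cmConjRingHom L)).transpose = Ha) (hdet : Ha.det ≠ 0)
    (Ψ : (Fin 4 → AdeleRing (𝓞 ↥(maximalRealSubfield L)) ↥(maximalRealSubfield L)) → ℂ) : Matrix (Fin 2) (Fin 2) (AdeleRing (𝓞 L) L) → ℂ :=
  fun x => Ψ (quatCoordInv L hHa hdet x)

/-- **The centre of record of the plane `h`**: `c(h) := piFinite (quatCoordInv_h 1)` — the finite-adelic part of the coordinates of `1 ∈ D_h` in the basis `quatBasis h`.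
[cite: VignerasLNM800, Ch. III §1] -/
def quatCompCentre (hHa : (Ha.map (cmConjRingHom L)).transpose = Ha) (hdet : Ha.det ≠ 0) :
    Fin 4 → FiniteAdeleRing (𝓞 ↥(maximalRealSubfield L)) ↥(maximalRealSubfield L) :=
  piFinite (↥(maximalRealSubfield L)) (Fin 4) (quatCoordInv L hHa hdet 1)

/-- Unfolding of `quatCompTestFun`. [folklore] -/
theorem quatCompTestFun_apply (hHa : (Ha.map (cmConjRingHom L)).transpose = Ha) (hdet : Ha.det ≠ 0)
    (Ψ : (Fin 4 → AdeleRing (𝓞 ↥(maximalRealSubfield L)) ↥(maximalRealSubfield L)) → ℂ) (x : Matrix (Fin 2) (Fin 2) (AdeleRing (𝓞 L) L)) :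
    quatCompTestFun L hHa hdet Ψ x = Ψ (quatCoordInv L hHa hdet x) :=
  rfl

/-- Unfolding of `quatCompCentre`. [folklore] -/
theorem quatCompCentre_def (hHa : (Ha.map (cmConjRingHom L)).transpose = Ha) (hdet : Ha.det ≠ 0) :
    quatCompCentre L hHa hdet = piFinite (↥(maximalRealSubfield L)) (Fin 4) (quatCoordInv L hHa hdet 1) :=
  rfl

/-- **`quatCompTestFun Ψ ∘ quatCoord = Ψ`** (★ `quatCoordInv_quatCoord`). [cite: VignerasLNM800, Ch. III §1] -/
theorem quatCompTestFun_quatCoord (hHa : (Ha.map (cmConjRingHom L)).transpose = Ha) (hdet : Ha.det ≠ 0)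
    (Ψ : (Fin 4 → AdeleRing (𝓞 ↥(maximalRealSubfield L)) ↥(maximalRealSubfield L)) → ℂ) (a : Fin 4 → AdeleRing (𝓞 ↥(maximalRealSubfield L)) ↥(maximalRealSubfield L)) :
    quatCompTestFun L hHa hdet Ψ (quatCoord L (fun i => ((quatBasis L Ha hHa hdet i : ↥(quatRatSubalgebra L Ha)) : Matrix (Fin 2) (Fin 2) L)) a) = Ψ a := by
  rw [quatCompTestFun_apply, quatCoordInv_quatCoord]

/-- **[SB]**: `quatCompTestFun Ψ ∈ quatSchwartzBruhat L (quatBasis h)` as soon as `Ψ ∈ piSchwartzBruhat L⁺ (Fin 4)` (★ #3g `mem_quatSchwartzBruhat_iff` is the definition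
`Φ ∘ quatCoord ∈ piSchwartzBruhat`). [cite: VignerasLNM800, Ch. II §4; Ch. III §2] [cite: WeilBNT1967, Ch. VII §2] -/
theorem quatCompTestFun_mem_quatSchwartzBruhat (hHa : (Ha.map (cmConjRingHom L)).transpose = Ha) (hdet : Ha.det ≠ 0)
    {Ψ : (Fin 4 → AdeleRing (𝓞 ↥(maximalRealSubfield L)) ↥(maximalRealSubfield L)) → ℂ} (hΨ : Ψ ∈ piSchwartzBruhat (↥(maximalRealSubfield L)) (Fin 4)) :
    quatCompTestFun L hHa hdet Ψ ∈ quatSchwartzBruhat L (fun i => ((quatBasis L Ha hHa hdet i : ↥(quatRatSubalgebra L Ha)) : Matrix (Fin 2) (Fin 2) L)) := by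
  rw [mem_quatSchwartzBruhat_iff]
  have h : (fun a => quatCompTestFun L hHa hdet Ψ
      (quatCoord L (fun i => ((quatBasis L Ha hHa hdet i : ↥(quatRatSubalgebra L Ha)) : Matrix (Fin 2) (Fin 2) L)) a)) = Ψ :=
    funext fun a => quatCompTestFun_quatCoord L hHa hdet Ψ a
  rw [h]
  exact hΨ

/-- **The Poisson integrand IS `Ψ`**: `∫ a, quatCompTestFun Ψ (quatCoord a) ∂μ = ∫ a, Ψ a ∂μ` for every measure `μ` on `(𝔸⁺)⁴`. [cite: VignerasLNM800, Ch. III §2 Thm. 2.2] -/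
theorem integral_quatCompTestFun_quatCoord (hHa : (Ha.map (cmConjRingHom L)).transpose = Ha) (hdet : Ha.det ≠ 0)
    [MeasurableSpace (AdeleRing (𝓞 ↥(maximalRealSubfield L)) ↥(maximalRealSubfield L))]
    (μ : Measure (Fin 4 → AdeleRing (𝓞 ↥(maximalRealSubfield L)) ↥(maximalRealSubfield L)))
    (Ψ : (Fin 4 → AdeleRing (𝓞 ↥(maximalRealSubfield L)) ↥(maximalRealSubfield L)) → ℂ) :
    ∫ a, quatCompTestFun L hHa hdet Ψ (quatCoord L (fun i => ((quatBasis L Ha hHa hdet i : ↥(quatRatSubalgebra L Ha)) : Matrix (Fin 2) (Fin 2) L)) a) ∂μ =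
      ∫ a, Ψ a ∂μ :=
  integral_congr_ae (Filter.Eventually.of_forall fun a => quatCompTestFun_quatCoord L hHa hdet Ψ a)

/-- **(Z1) — THE COMPARISON TEST FUNCTIONS SATISFY ‹ZE›'s [SB] AND [POISSON]-EQUALITY**, token for token: for two hermitian planes `h₁ = Ha₁`, `h₂ = Ha₂` (`det ≠ 0`), one
archimedean Schwartz factor `Ψ∞`, one level `𝔫`, and the test functions of record `Φᵢ := quatCompTestFun L hHaᵢ hdetᵢ (cosetTestFun L⁺ (Fin 4) Ψ∞ 𝔫 (quatCompCentre L hHaᵢ hdetᵢ))`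
(`= (Ψ∞ ⊗ 1_{cᵢ + (𝔫𝒪̂)⁴}) ∘ quatCoordInv_{hᵢ}`): each `Φᵢ ∈ quatSchwartzBruhat L (quatBasis hᵢ)`, and `∫ Φ₁ ∘ quatCoord₁ dν⁴ = ∫ Φ₂ ∘ quatCoord₂ dν⁴` for G3's product measure
`ν⁴ = Measure.pi fun _ => ν` of any additive Haar `ν` on `𝔸⁺` (both sides are `∫ Ψ∞ ⊗ 1_{(𝔫𝒪̂)⁴} dν⁴` by translation invariance).
[cite: VignerasLNM800, Ch. III §2 Thm. 2.2–2.3] [cite: WeilBNT1967, Ch. VII §2, §6] [cite: CasselsFrohlichANT1967, Ch. XV (Tate) Lemma 4.2.4, Thm. 4.4.1] -/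
theorem comparisonTestFun_spec
    [MeasurableSpace (AdeleRing (𝓞 ↥(maximalRealSubfield L)) ↥(maximalRealSubfield L))] [BorelSpace (AdeleRing (𝓞 ↥(maximalRealSubfield L)) ↥(maximalRealSubfield L))]
    (ν : Measure (AdeleRing (𝓞 ↥(maximalRealSubfield L)) ↥(maximalRealSubfield L))) [ν.IsAddHaarMeasure]
    (Ψinf : 𝓢((Fin 4 → mixedSpace ↥(maximalRealSubfield L)), ℂ)) (𝔫 : Ideal (𝓞 ↥(maximalRealSubfield L)))
    (Ha₁ : Matrix (Fin 2) (Fin 2) L) (hHa₁ : (Ha₁.map (cmConjRingHom L)).transpose = Ha₁) (hdet₁ : Ha₁.det ≠ 0)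
    (Ha₂ : Matrix (Fin 2) (Fin 2) L) (hHa₂ : (Ha₂.map (cmConjRingHom L)).transpose = Ha₂) (hdet₂ : Ha₂.det ≠ 0) :
    quatCompTestFun L hHa₁ hdet₁ (cosetTestFun (↥(maximalRealSubfield L)) (Fin 4) Ψinf 𝔫 (quatCompCentre L hHa₁ hdet₁)) ∈
        quatSchwartzBruhat L (fun i => ((quatBasis L Ha₁ hHa₁ hdet₁ i : ↥(quatRatSubalgebra L Ha₁)) : Matrix (Fin 2) (Fin 2) L)) ∧
      quatCompTestFun L hHa₂ hdet₂ (cosetTestFun (↥(maximalRealSubfield L)) (Fin 4) Ψinf 𝔫 (quatCompCentre L hHa₂ hdet₂)) ∈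
        quatSchwartzBruhat L (fun i => ((quatBasis L Ha₂ hHa₂ hdet₂ i : ↥(quatRatSubalgebra L Ha₂)) : Matrix (Fin 2) (Fin 2) L)) ∧
      (∫ a, quatCompTestFun L hHa₁ hdet₁ (cosetTestFun (↥(maximalRealSubfield L)) (Fin 4) Ψinf 𝔫 (quatCompCentre L hHa₁ hdet₁))
            (quatCoord L (fun i => ((quatBasis L Ha₁ hHa₁ hdet₁ i : ↥(quatRatSubalgebra L Ha₁)) : Matrix (Fin 2) (Fin 2) L)) a) ∂(Measure.pi fun _ : Fin 4 => ν)) =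
        (∫ a, quatCompTestFun L hHa₂ hdet₂ (cosetTestFun (↥(maximalRealSubfield L)) (Fin 4) Ψinf 𝔫 (quatCompCentre L hHa₂ hdet₂))
            (quatCoord L (fun i => ((quatBasis L Ha₂ hHa₂ hdet₂ i : ↥(quatRatSubalgebra L Ha₂)) : Matrix (Fin 2) (Fin 2) L)) a) ∂(Measure.pi fun _ : Fin 4 => ν)) := by
  haveI := locallyCompactSpace_adeleRing' (↥(maximalRealSubfield L))
  haveI := secondCountableTopology_adeleRing (↥(maximalRealSubfield L))
  haveI : (Measure.pi fun _ : Fin 4 => ν).IsAddHaarMeasure := inferInstance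
  refine ⟨quatCompTestFun_mem_quatSchwartzBruhat L hHa₁ hdet₁ (cosetTestFun_mem_piSchwartzBruhat Ψinf 𝔫 _),
    quatCompTestFun_mem_quatSchwartzBruhat L hHa₂ hdet₂ (cosetTestFun_mem_piSchwartzBruhat Ψinf 𝔫 _), ?_⟩
  rw [integral_quatCompTestFun_quatCoord, integral_quatCompTestFun_quatCoord]
  exact integral_cosetTestFun_eq_integral_cosetTestFun _ Ψinf 𝔫 _ _

/-- **(Z1) — [POISSON] `≠ 0` FOR THE DEFAULT ARCHIMEDEAN FACTOR**: with `Ψ∞ := archBump`, the common Poisson numerator is non-zero: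
`∫ Φ₁ ∘ quatCoord₁ dν⁴ ≠ 0` (it is the positive real `∫ b(a_∞) 1_{(𝔫𝒪̂)⁴}(a_f) dν⁴(a)`). [cite: VignerasLNM800, Ch. III §2 Thm. 2.2] [cite: WeilBNT1967, Ch. VII §2] -/
theorem comparisonTestFun_integral_ne_zero
    [MeasurableSpace (AdeleRing (𝓞 ↥(maximalRealSubfield L)) ↥(maximalRealSubfield L))] [BorelSpace (AdeleRing (𝓞 ↥(maximalRealSubfield L)) ↥(maximalRealSubfield L))]
    (ν : Measure (AdeleRing (𝓞 ↥(maximalRealSubfield L)) ↥(maximalRealSubfield L))) [ν.IsAddHaarMeasure]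
    (𝔫 : Ideal (𝓞 ↥(maximalRealSubfield L))) (hHa : (Ha.map (cmConjRingHom L)).transpose = Ha) (hdet : Ha.det ≠ 0) :
    (∫ a, quatCompTestFun L hHa hdet (cosetTestFun (↥(maximalRealSubfield L)) (Fin 4) (archBump (↥(maximalRealSubfield L)) (Fin 4)) 𝔫 (quatCompCentre L hHa hdet))
        (quatCoord L (fun i => ((quatBasis L Ha hHa hdet i : ↥(quatRatSubalgebra L Ha)) : Matrix (Fin 2) (Fin 2) L)) a) ∂(Measure.pi fun _ : Fin 4 => ν)) ≠ 0 := by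
  haveI := locallyCompactSpace_adeleRing' (↥(maximalRealSubfield L))
  haveI := secondCountableTopology_adeleRing (↥(maximalRealSubfield L))
  haveI : (Measure.pi fun _ : Fin 4 => ν).IsAddHaarMeasure := inferInstance
  rw [integral_quatCompTestFun_quatCoord]
  exact integral_cosetTestFun_archBump_ne_zero _ 𝔫 _

/-- **The support condition of `Φ_h` on `D_{h,𝔸}` read in coordinates**: for `x = quatCoord_h a` (every element of `D_{h,𝔸}` is of this form, ★ `exists_quatCoord_eq`),
`Φ_h x = Ψ∞(a_∞) · 1[(a_f − c(h)) ∈ (𝔫𝒪̂)⁴]` and the bracket holds iff every local tuple lies in `localCosetBox L⁺ (Fin 4) 𝔫 c(h) v` — the entry point for the placewise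
factorisation of [EULER]. [cite: CasselsFrohlichANT1967, Ch. XV (Tate) §3.3, Thm. 4.4.1] -/
theorem comparisonTestFun_quatCoord_apply (hHa : (Ha.map (cmConjRingHom L)).transpose = Ha) (hdet : Ha.det ≠ 0)
    (Ψinf : 𝓢((Fin 4 → mixedSpace ↥(maximalRealSubfield L)), ℂ)) (𝔫 : Ideal (𝓞 ↥(maximalRealSubfield L)))
    (a : Fin 4 → AdeleRing (𝓞 ↥(maximalRealSubfield L)) ↥(maximalRealSubfield L)) :
    quatCompTestFun L hHa hdet (cosetTestFun (↥(maximalRealSubfield L)) (Fin 4) Ψinf 𝔫 (quatCompCentre L hHa hdet))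
        (quatCoord L (fun i => ((quatBasis L Ha hHa hdet i : ↥(quatRatSubalgebra L Ha)) : Matrix (Fin 2) (Fin 2) L)) a) =
      Ψinf (piArch (↥(maximalRealSubfield L)) (Fin 4) a) *
        (piLevelIdeal (↥(maximalRealSubfield L)) (Fin 4) 𝔫 : Set (Fin 4 → FiniteAdeleRing (𝓞 ↥(maximalRealSubfield L)) ↥(maximalRealSubfield L))).indicator
          (fun _ => (1 : ℂ)) (piFinite (↥(maximalRealSubfield L)) (Fin 4) a - quatCompCentre L hHa hdet) := by
  rw [quatCompTestFun_quatCoord, cosetTestFun_apply]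

end Quat

end Summit.HodgeConjecture.HodgeConjecture.Cruxes.H413.K2E5QuatComparisonTestFunction

end
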